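import Mathlib
import Summits.CriticalPhenomena.PercolationContinuityZ3.Theorems.PercNearOneGluingNoHeavyLowerTailBandTwoCM
import Summits.CriticalPhenomena.PercolationContinuityZ3.Theorems.PercNearOneGluingNoHeavyLowerTailBandTwoNeutralEuler
import HarnessLib

/-!
# Quadratic-row kernels, III: the neutral grabber (`q_B = 1`), Type II — an explicit completely monotone annihilator

Support file for the Sahi / Conjecture-P programme of route `PercNearOneGluingNoHeavy`
(`--supports stmt-CriticalPhenomena-4575`, prover prim-l12-p5 gen 44; proof note
`prim-l12-p5/PROOF-QB1-HYPERGEOMETRIC-g44.md` §2–§3 and §3.3 (discrete form)).  No definitions, no named facts, no sorries.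

Companion of `…LowerTailBandTwoCM` (`bandTwo_choose_tn_of_cm`: a strictly completely monotone solution `μ` of
`A_n μ_n + B_n μ_{n-1} + C_n μ_{n-2} = 0` with `C ≤ 0` and `A_1 μ_1 + B_1 μ_0 ≥ 0` peels the band) and of
`…LowerTailBandTwoNeutralEuler` (the Euler-type integral `J`).  Here we CONSTRUCT such a `μ` for the three-ray band
with a NEUTRAL grabber (`q_B = 1`, i.e. `g_B = 1`, `a = 0`) in the mixed regime ("Type II": one integer copy below
B's ray, `w₁ > 0`, one sub-neutral copy above it, `-g₂λ < w₂ < 0`).  After the positive row scaling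
`n(n-1)/u^{(m)}_{n-2}` the band of LEMMA A (g43) at `q_B = 1` is polynomial in `n`:
`Ã_n = λ²(g₁g₂ n(n-1) + (g₁+g₂)(p+1) n + p(p+1))`, `B̃_n = λ n ((w₁g₂+w₂g₁)(n-1) + (w₁+w₂)(p+1))`,
`C̃_n = w₁w₂ n(n-1)` (`p = s+1+θ > 0`, `λ = λ_B`, `w_i = b_i - g_iλ`); up to the positive row factor
`λ^{-2}(m+1+θ)_{n-2}/(m+1)_{n-2}` (rows `n ≥ 2`; rows `0, 1`: `m(m-1)/(λ²p(p+1))`, `m/(λ²(p+1))`) it is also the band of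
`…LowerTailBandTwoHyp` at `g = 1` (Chu–Vandermonde `₂F₁(-θ,-n;c;1) = (c+θ)_n/(c)_n`).

**THEOREM (`threeRay_typeII_tn_neutral`).**  For `λ > 0`, `p > 0`, `g₁ > 0`, `0 < g₂ ≤ 1`, `w₁ > 0 > w₂ > -g₂λ` the
kernel `Ã_n C(n,l) + B̃_n C(n-1,l) + C̃_n C(n-2,l)` is totally nonnegative.
**THEOREM (`threeRay_typeIII_tn_neutral`).**  The same kernel is totally nonnegative for `0 ≤ g₁, g₂ ≤ 1`, `w₁, w₂ > 0`
(both copies below B's ray; g43's THEOREM N₃-III at the endpoint `g = 1`, which `…BandTwoHyp` excludes): the chain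
condition `4Ã_{n-1}C̃_n ≤ B̃_{n-1}B̃_n` is an explicit quadratic-form inequality (`chain_poly`, equality for two identical
neutral copies) and `BandTwoTN.bandTwo_choose_tn` applies.

The annihilator: with `R_i = (p+1)/g_i`, `x₁ ≥ x₂ > 0` the roots of `x² - (R₁+R₂-1)x + pR₁R₂/(p+1)` (`R₁ ≤ x₁`),
`Y = -w₂/(g₂λ) ∈ (0,1]`, `c' = w₁/(g₁λ) > 0`, `J(s) = ∫_0^Y u^s (Y-u)^{x₁-R₁} (u+c')^{R₁-1-x₂} du`, one takes
`μ_n = (∏_{i≤n} i/(i+x₂))·J(n+x₂)`, a product of two completely monotone sequences; the recurrence is ONE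
integration by parts for `J` (`J_contig`), and `Ã_1 μ_1 + B̃_1 μ_0 = λ²g₁g₂ x₂ Y c'·J(x₂-1) > 0`.  On the measure
side `μ` is the moment sequence of the hypergeometric density `(1-x)^{r₂}₂F₁(x₁-r₁, x₂-r₁; R₂; 1-x)` of the memo.
-/

namespace Summit.CriticalPhenomena.PercolationContinuityZ3.Theorems

namespace BandTwoNeutral

open Finset Real MeasureTheory intervalIntegral MomentRatioTN
open scoped Nat

/-! ### The main theorem: the neutral-grabber three-ray band in Type II is totally nonnegative -/

/-- **THEOREM N₃-II at `q_B = 1` (kernel form).**  For `λ > 0`, `p > 0`, `g₁ > 0`, `0 < g₂ ≤ 1`, `w₁ > 0`, `-g₂λ < w₂ < 0`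
(copy 1 below B's ray, copy 2 sub-neutral and above it),
the quadratic-row kernel `Ã_n C(n,l) + B̃_n C(n-1,l) + C̃_n C(n-2,l)` with
`Ã_n = λ²(g₁g₂n(n-1) + (g₁+g₂)(p+1)n + p(p+1))`, `B̃_n = λn((w₁g₂+w₂g₁)(n-1) + (w₁+w₂)(p+1))`, `C̃_n = w₁w₂n(n-1)`
(the three-ray band of LEMMA A at `q_B = 1`, row-scaled) is totally nonnegative. -/
theorem threeRay_typeII_tn_neutral (lam p g₁ g₂ w₁ w₂ : ℝ) (hlam : 0 < lam) (hp : 0 < p)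
    (hg₁ : 0 < g₁) (hg₂ : 0 < g₂) (hg₂1 : g₂ ≤ 1)
    (hw₁ : 0 < w₁) (hw₂ : w₂ < 0) (hb₂ : 0 < w₂ + g₂ * lam)
    {k : ℕ} (r c : Fin k → ℕ) (hr : StrictMono r) (hc : StrictMono c) :
    0 ≤ (Matrix.of fun i j =>
        (lam ^ 2 * (g₁ * g₂ * (r i : ℝ) * ((r i : ℝ) - 1) + (g₁ + g₂) * (p + 1) * (r i : ℝ) + p * (p + 1)))
            * ((r i).choose (c j) : ℝ)
        + (lam * (r i : ℝ) * ((w₁ * g₂ + w₂ * g₁) * ((r i : ℝ) - 1) + (w₁ + w₂) * (p + 1)))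
            * (((r i) - 1).choose (c j) : ℝ)
        + (w₁ * w₂ * (r i : ℝ) * ((r i : ℝ) - 1)) * (((r i) - 2).choose (c j) : ℝ)).det := by
  -- the three coefficient sequences
  let A : ℕ → ℝ := fun n =>
    lam ^ 2 * (g₁ * g₂ * (n : ℝ) * ((n : ℝ) - 1) + (g₁ + g₂) * (p + 1) * (n : ℝ) + p * (p + 1))
  let B : ℕ → ℝ := fun n => lam * (n : ℝ) * ((w₁ * g₂ + w₂ * g₁) * ((n : ℝ) - 1) + (w₁ + w₂) * (p + 1))
  let C : ℕ → ℝ := fun n => w₁ * w₂ * (n : ℝ) * ((n : ℝ) - 1)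
  -- the roots and the parameters of the annihilator
  obtain ⟨x₁, x₂, hgS, hgP, hx₂pos, hx₂lex₁, hRx₁⟩ := typeII_roots p g₁ g₂ hp hg₁ hg₂ hg₂1
  set R₁ : ℝ := (p + 1) / g₁ with hR₁
  have hgR₁ : g₁ * R₁ = p + 1 := by rw [hR₁]; field_simp
  have hα : 0 ≤ x₁ - R₁ := by linarith
  set Y : ℝ := -w₂ / (g₂ * lam) with hY
  set c' : ℝ := w₁ / (g₁ * lam) with hc'
  have hYg : Y * (g₂ * lam) = -w₂ := by rw [hY]; field_simp
  have hcg : c' * (g₁ * lam) = w₁ := by rw [hc']; field_simp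
  have hY0 : 0 < Y := by rw [hY]; exact div_pos (by linarith) (by positivity)
  have hY1 : Y ≤ 1 := by
    rw [hY, div_le_one (by positivity)]; linarith
  have hc'0 : 0 < c' := by rw [hc']; positivity
  clear_value R₁ Y c'
  -- the annihilator μ_n = a_n · J(n + x₂)
  let a : ℕ → ℝ := fun n => ∏ m ∈ range n, (((m : ℝ) + 1) / ((m : ℝ) + 1 + x₂))
  let J : ℝ → ℝ := fun t => ∫ u in (0:ℝ)..Y, u ^ t * ((Y - u) ^ (x₁ - R₁) * (u + c') ^ (R₁ - 1 - x₂))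
  let μ : ℕ → ℝ := fun n => a n * J ((n : ℝ) + x₂)
  have ha0 : ∀ n, 0 < a n := fun n => prodRatio_pos x₂ hx₂pos n
  have ha_succ : ∀ n : ℕ, a (n + 1) * ((n : ℝ) + 1 + x₂) = a n * ((n : ℝ) + 1) := by
    intro n
    show (∏ m ∈ range (n + 1), (((m : ℝ) + 1) / ((m : ℝ) + 1 + x₂))) * ((n : ℝ) + 1 + x₂)
      = (∏ m ∈ range n, (((m : ℝ) + 1) / ((m : ℝ) + 1 + x₂))) * ((n : ℝ) + 1)
    rw [prod_range_succ]
    have : (n : ℝ) + 1 + x₂ ≠ 0 := by positivity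
    field_simp
  -- strict complete monotonicity of μ (positive CM × strictly CM)
  have hμcm : ∀ k j, 0 < ∑ i ∈ range (k + 1), (-1 : ℝ) ^ i * (k.choose i : ℝ) * μ (j + i) := by
    intro k j
    exact MomentRatioTN.altSum_mul_pos_of_pos a (fun n => J ((n : ℝ) + x₂)) ha0
      (fun k' j' => prodRatio_altSum_nonneg x₂ hx₂pos k' j')
      (fun k' j' => J_altSum_pos Y c' (x₁ - R₁) (R₁ - 1 - x₂) x₂ hY0 hY1 hc'0 hα hx₂pos k' j') k j
  -- the contiguity relation
  have hcontig : ∀ t : ℝ, -1 < t →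
      (t + (x₁ - R₁) + (R₁ - 1 - x₂) + 3) * J (t + 2)
        = ((t + 1) * (Y - c') - ((x₁ - R₁) + 1) * c' + ((R₁ - 1 - x₂) + 1) * Y) * J (t + 1)
          + (t + 1) * Y * c' * J t :=
    fun t ht => J_contig Y c' (x₁ - R₁) (R₁ - 1 - x₂) t hY0 hc'0 hα ht
  -- closed forms of the coefficients through x₁, x₂, Y, c'
  have hAx : ∀ n : ℕ, A n = lam ^ 2 * g₁ * g₂ * ((n : ℝ) + x₁) * ((n : ℝ) + x₂) := by
    intro n
    show lam ^ 2 * (g₁ * g₂ * (n : ℝ) * ((n : ℝ) - 1) + (g₁ + g₂) * (p + 1) * (n : ℝ) + p * (p + 1)) = _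
    linear_combination (-(lam ^ 2 * (n : ℝ))) * hgS - lam ^ 2 * hgP
  have hBx : ∀ n : ℕ, B n = -(lam ^ 2 * g₁ * g₂ * (n : ℝ)) *
      ((((n : ℝ) - 1 + x₂) * (Y - c') - ((x₁ - R₁) + 1) * c' + ((R₁ - 1 - x₂) + 1) * Y)) := by
    intro n
    show lam * (n : ℝ) * ((w₁ * g₂ + w₂ * g₁) * ((n : ℝ) - 1) + (w₁ + w₂) * (p + 1)) = _
    have hx1 : x₁ = ((g₁ + g₂) * (p + 1) - g₁ * g₂) / (g₁ * g₂) - x₂ := by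
      field_simp
      linarith [hgS]
    rw [hx1, hY, hc', hR₁]
    field_simp
    ring
  have hCx : ∀ n : ℕ, C n = -(lam ^ 2 * g₁ * g₂ * (n : ℝ) * ((n : ℝ) - 1)) * (Y * c') := by
    intro n
    show w₁ * w₂ * (n : ℝ) * ((n : ℝ) - 1) = _
    rw [hY, hc']
    field_simp
  -- apply the abstract peeling theorem
  refine BandTwoCM.bandTwo_choose_tn_of_cm A B C μ ?_ ?_ ?_ ?_ ?_ hμcm ?_ ?_ r c hr hc
  · -- A_n > 0
    intro n
    show 0 < lam ^ 2 * (g₁ * g₂ * (n : ℝ) * ((n : ℝ) - 1) + (g₁ + g₂) * (p + 1) * (n : ℝ) + p * (p + 1))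
    have hn : (0 : ℝ) ≤ (n : ℝ) * ((n : ℝ) - 1) := by
      rcases Nat.eq_zero_or_pos n with h0 | h1
      · subst h0; simp
      · have : (1 : ℝ) ≤ n := by exact_mod_cast h1
        exact mul_nonneg (by linarith) (by linarith)
    have h2 : 0 ≤ g₁ * g₂ * (n : ℝ) * ((n : ℝ) - 1) := by
      have := mul_nonneg (mul_pos hg₁ hg₂).le hn; linarith
    positivity
  · -- B_0 = 0
    show lam * ((0 : ℕ) : ℝ) * _ = 0
    simp
  · -- C_n ≤ 0
    intro n
    show w₁ * w₂ * (n : ℝ) * ((n : ℝ) - 1) ≤ 0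
    have hn : (0 : ℝ) ≤ (n : ℝ) * ((n : ℝ) - 1) := by
      rcases Nat.eq_zero_or_pos n with h0 | h1
      · subst h0; simp
      · have : (1 : ℝ) ≤ n := by exact_mod_cast h1
        exact mul_nonneg (by linarith) (by linarith)
    have hw : w₁ * w₂ ≤ 0 := (mul_neg_of_pos_of_neg hw₁ hw₂).le
    have := mul_nonpos_of_nonpos_of_nonneg hw hn
    linarith
  · show w₁ * w₂ * ((0 : ℕ) : ℝ) * _ = 0
    simp
  · show w₁ * w₂ * ((1 : ℕ) : ℝ) * (((1 : ℕ) : ℝ) - 1) = 0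
    simp
  · -- the recurrence for n ≥ 2: one contiguity relation
    intro n hn
    obtain ⟨m, rfl⟩ : ∃ m, n = m + 2 := ⟨n - 2, by omega⟩
    have e1 : (m + 2 - 1 : ℕ) = m + 1 := by omega
    have e2 : (m + 2 - 2 : ℕ) = m := by omega
    rw [e1, e2]
    show A (m + 2) * (a (m + 2) * J (((m + 2 : ℕ) : ℝ) + x₂)) + B (m + 2) * (a (m + 1) * J (((m + 1 : ℕ) : ℝ) + x₂))
      + C (m + 2) * (a m * J ((m : ℝ) + x₂)) = 0
    have hc1 := hcontig ((m : ℝ) + x₂) (by linarith)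
    have hd1 : ((m : ℝ) + 1 + x₂) ≠ 0 := by positivity
    have hd2 : ((m : ℝ) + 2 + x₂) ≠ 0 := by positivity
    have hinv1 : ((m : ℝ) + 1 + x₂) * ((m : ℝ) + 1 + x₂)⁻¹ = 1 := mul_inv_cancel₀ hd1
    have hinv2 : ((m : ℝ) + 2 + x₂) * ((m : ℝ) + 2 + x₂)⁻¹ = 1 := mul_inv_cancel₀ hd2
    have v1 : a (m + 1) = a m * ((m : ℝ) + 1) * ((m : ℝ) + 1 + x₂)⁻¹ := by
      rw [eq_mul_inv_iff_mul_eq₀ hd1]; exact ha_succ m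
    have v2 : a (m + 2) = a m * ((m : ℝ) + 1) * ((m : ℝ) + 2) * ((m : ℝ) + 1 + x₂)⁻¹ * ((m : ℝ) + 2 + x₂)⁻¹ := by
      have h := ha_succ (m + 1)
      push_cast at h
      have h' : a (m + 2) * ((m : ℝ) + 2 + x₂) = a (m + 1) * ((m : ℝ) + 2) := by
        have e : ((m : ℝ) + 1 + 1) = (m : ℝ) + 2 := by ring
        rw [e] at h; exact h
      rw [eq_mul_inv_iff_mul_eq₀ hd2, h', v1]; ring
    have eJ2 : J (((m + 2 : ℕ) : ℝ) + x₂) = J ((m : ℝ) + x₂ + 2) := by push_cast; ring_nf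
    have eJ1 : J (((m + 1 : ℕ) : ℝ) + x₂) = J ((m : ℝ) + x₂ + 1) := by push_cast; ring_nf
    rw [eJ2, eJ1, v2, v1, hAx, hBx, hCx]
    push_cast
    linear_combination (lam ^ 2 * g₁ * g₂ * a m * ((m : ℝ) + 1) * ((m : ℝ) + 2) * ((m : ℝ) + 1 + x₂)⁻¹) * hc1
      + (lam ^ 2 * g₁ * g₂ * a m * ((m : ℝ) + 1) * ((m : ℝ) + 2) * ((m : ℝ) + 2 + x₁) * J ((m : ℝ) + x₂ + 2)
          * ((m : ℝ) + 1 + x₂)⁻¹) * hinv2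
      + (lam ^ 2 * g₁ * g₂ * a m * ((m : ℝ) + 1) * ((m : ℝ) + 2) * (Y * c') * J ((m : ℝ) + x₂)) * hinv1
  · -- row 1: A_1 μ_1 + B_1 μ_0 = λ² g₁ g₂ x₂ Y c' · J(x₂ - 1) ≥ 0
    show 0 ≤ A 1 * (a 1 * J (((1 : ℕ) : ℝ) + x₂)) + B 1 * (a 0 * J (((0 : ℕ) : ℝ) + x₂))
    rw [hAx, hBx]
    have hc0 := hcontig (x₂ - 1) (by linarith)
    have ha1 : a 1 = 1 / (1 + x₂) := by
      show (∏ m ∈ range 1, (((m : ℝ) + 1) / ((m : ℝ) + 1 + x₂))) = 1 / (1 + x₂)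
      simp
    have ha0' : a 0 = 1 := by
      show (∏ m ∈ range 0, (((m : ℝ) + 1) / ((m : ℝ) + 1 + x₂))) = 1
      simp
    rw [ha1, ha0']
    push_cast
    have eJa : J (x₂ - 1 + 2) = J (1 + x₂) := by ring_nf
    have eJb : J (x₂ - 1 + 1) = J (0 + x₂) := by ring_nf
    rw [eJa, eJb] at hc0
    have hJ : 0 < J (x₂ - 1) := J_pos Y c' (x₁ - R₁) (R₁ - 1 - x₂) (x₂ - 1) hY0 hc'0 hα (by linarith)
    have hd : (0 : ℝ) < 1 + x₂ := by positivity
    have e : lam ^ 2 * g₁ * g₂ * ((1 : ℝ) + x₁) * ((1 : ℝ) + x₂) * (1 / (1 + x₂) * J (1 + x₂))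
        + -(lam ^ 2 * g₁ * g₂ * (1 : ℝ)) * ((((1 : ℝ) - 1 + x₂) * (Y - c') - ((x₁ - R₁) + 1) * c'
          + ((R₁ - 1 - x₂) + 1) * Y)) * (1 * J (0 + x₂))
        = lam ^ 2 * g₁ * g₂ * (x₂ * Y * c') * J (x₂ - 1) := by
      have e1 : lam ^ 2 * g₁ * g₂ * ((1 : ℝ) + x₁) * ((1 : ℝ) + x₂) * (1 / (1 + x₂) * J (1 + x₂))
          = lam ^ 2 * g₁ * g₂ * ((1 : ℝ) + x₁) * J (1 + x₂) := by
        field_simp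
      rw [e1]
      linear_combination (lam ^ 2 * g₁ * g₂) * hc0
    rw [e]
    positivity

/-! ### Type III at `q_B = 1` (both copies below B's ray): the chain condition for the polynomial band -/

/-- The chain inequality `4 Ã_{n-1} C̃_n ≤ B̃_{n-1} B̃_n` of the neutral-grabber band with both copies below B's ray,
after removing the common factor `λ² n (n-1)`: for `k ≥ 1`, `P ≥ 1`, `0 ≤ g₁, g₂ ≤ 1` (any real `w₁, w₂`),
`4 w₁ w₂ (g₁g₂ k(k-1) + (g₁+g₂) P k + (P-1) P) ≤ (σ (k-1) + τ P)(σ k + τ P)` with `σ = w₁g₂ + w₂g₁`, `τ = w₁ + w₂`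
(equality for two identical neutral copies).  Proof: a quadratic form in `(w₁, w₂)` with nonnegative discriminant margin. -/
theorem chain_poly (k P g₁ g₂ w₁ w₂ : ℝ) (hk : 1 ≤ k) (hP : 1 ≤ P) (hg₁ : 0 ≤ g₁) (hg₁1 : g₁ ≤ 1)
    (hg₂ : 0 ≤ g₂) (hg₂1 : g₂ ≤ 1) :
    4 * w₁ * w₂ * (g₁ * g₂ * k * (k - 1) + (g₁ + g₂) * P * k + (P - 1) * P)
      ≤ ((w₁ * g₂ + w₂ * g₁) * (k - 1) + (w₁ + w₂) * P) * ((w₁ * g₂ + w₂ * g₁) * k + (w₁ + w₂) * P) := by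
  -- coefficients of the quadratic form in (w₁, w₂)
  set F₁ : ℝ := (g₁ * k + P) * (g₁ * (k - 1) + P) with hF₁
  set F₂ : ℝ := (g₂ * k + P) * (g₂ * (k - 1) + P) with hF₂
  set X : ℝ := 2 * g₁ * g₂ * k * (k - 1) + P * (2 * k + 1) * (g₁ + g₂) + 2 * P * (P - 2) with hX
  have hform : ((w₁ * g₂ + w₂ * g₁) * (k - 1) + (w₁ + w₂) * P) * ((w₁ * g₂ + w₂ * g₁) * k + (w₁ + w₂) * P)
      - 4 * w₁ * w₂ * (g₁ * g₂ * k * (k - 1) + (g₁ + g₂) * P * k + (P - 1) * P)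
      = w₁ ^ 2 * F₂ + w₂ ^ 2 * F₁ - w₁ * w₂ * X := by
    rw [hF₁, hF₂, hX]; ring
  have hF₂pos : 0 < F₂ := by
    rw [hF₂]
    have h1 : 0 < g₂ * k + P := by nlinarith
    have h2 : 0 < g₂ * (k - 1) + P := by nlinarith
    exact mul_pos h1 h2
  -- the discriminant margin: 4 F₁ F₂ - X² = 2δ(U+V) - δ² - P²(g₁-g₂)², δ = 2P(2-g₁-g₂), U+V = X + δ
  have hdisc : 0 ≤ 4 * F₁ * F₂ - X ^ 2 := by
    set δ : ℝ := 2 * P * (2 - g₁ - g₂) with hδ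
    have hδ0 : 0 ≤ δ := by rw [hδ]; nlinarith
    have e : 4 * F₁ * F₂ - X ^ 2 = 2 * δ * (X + δ) - δ ^ 2 - P ^ 2 * (g₁ - g₂) ^ 2 := by
      rw [hF₁, hF₂, hX, hδ]; ring
    have hUV : 2 * P ^ 2 + P * (g₁ + g₂) ≤ X + δ := by
      rw [hX, hδ]
      have h1 : 0 ≤ g₁ * g₂ * k * (k - 1) := by
        have := mul_nonneg (mul_nonneg hg₁ hg₂) (mul_nonneg (by linarith : (0:ℝ) ≤ k) (by linarith : (0:ℝ) ≤ k - 1))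
        linarith [this]
      nlinarith [mul_nonneg (by linarith : (0:ℝ) ≤ P) (mul_nonneg (add_nonneg hg₁ hg₂) (by linarith : (0:ℝ) ≤ k - 1))]
    -- (2-g₁-g₂)(P-1+g₁+g₂) ≥ (g₁-g₂)²
    have hsq : (g₁ - g₂) ^ 2 ≤ (2 - g₁ - g₂) * (P - 1 + g₁ + g₂) := by
      have ha : |g₁ - g₂| ≤ 2 - g₁ - g₂ := by
        rw [abs_le]; constructor <;> linarith
      have hb : |g₁ - g₂| ≤ P - 1 + g₁ + g₂ := by
        rw [abs_le]; constructor <;> linarith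
      have h0 : 0 ≤ |g₁ - g₂| := abs_nonneg _
      calc (g₁ - g₂) ^ 2 = |g₁ - g₂| * |g₁ - g₂| := by rw [← sq, sq_abs]
        _ ≤ (2 - g₁ - g₂) * (P - 1 + g₁ + g₂) := mul_le_mul ha hb h0 (by linarith)
    rw [e]
    have h3 : 2 * δ * (X + δ) - δ ^ 2 ≥ 2 * δ * (2 * P ^ 2 + P * (g₁ + g₂)) - δ ^ 2 := by
      nlinarith [mul_le_mul_of_nonneg_left hUV (by linarith : (0:ℝ) ≤ 2 * δ)]
    have h4 : 2 * δ * (2 * P ^ 2 + P * (g₁ + g₂)) - δ ^ 2 = 8 * P ^ 2 * ((2 - g₁ - g₂) * (P - 1 + g₁ + g₂)) := by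
      rw [hδ]; ring
    have h5 : P ^ 2 * (g₁ - g₂) ^ 2 ≤ P ^ 2 * ((2 - g₁ - g₂) * (P - 1 + g₁ + g₂)) :=
      mul_le_mul_of_nonneg_left hsq (sq_nonneg P)
    nlinarith
  -- conclude: 4 F₂ · (form) = (2 F₂ w₁ - X w₂)² + w₂² (4 F₁ F₂ - X²) ≥ 0
  have hq : 0 ≤ w₁ ^ 2 * F₂ + w₂ ^ 2 * F₁ - w₁ * w₂ * X := by
    have e : 4 * F₂ * (w₁ ^ 2 * F₂ + w₂ ^ 2 * F₁ - w₁ * w₂ * X)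
        = (2 * F₂ * w₁ - X * w₂) ^ 2 + w₂ ^ 2 * (4 * F₁ * F₂ - X ^ 2) := by ring
    have h : 0 ≤ 4 * F₂ * (w₁ ^ 2 * F₂ + w₂ ^ 2 * F₁ - w₁ * w₂ * X) := by
      rw [e]; exact add_nonneg (sq_nonneg _) (mul_nonneg (sq_nonneg _) hdisc)
    by_contra hneg
    push Not at hneg
    have : 4 * F₂ * (w₁ ^ 2 * F₂ + w₂ ^ 2 * F₁ - w₁ * w₂ * X) < 0 := by
      have := mul_pos (by linarith : (0:ℝ) < 4 * F₂) (by linarith : 0 < -(w₁ ^ 2 * F₂ + w₂ ^ 2 * F₁ - w₁ * w₂ * X))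
      linarith
    linarith
  linarith [hform, hq]

/-- **THEOREM N₃-III at `q_B = 1` (kernel form; g43's theorem at the endpoint `g = 1` excluded by
`…BandTwoHyp.threeRay_below_tn`).**  For `λ > 0`, `p > 0`, `0 ≤ g₁, g₂ ≤ 1`, `w₁, w₂ > 0` (both copies on/below B's
ray) the polynomial three-ray band `Ã_n C(n,l) + B̃_n C(n-1,l) + C̃_n C(n-2,l)` is totally nonnegative: the chain
condition `4Ã_{n-1}C̃_n ≤ B̃_{n-1}B̃_n` (`chain_poly`) and `BandTwoTN.bandTwo_choose_tn`. -/
theorem threeRay_typeIII_tn_neutral (lam p g₁ g₂ w₁ w₂ : ℝ) (hlam : 0 < lam) (hp : 0 < p)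
    (hg₁ : 0 ≤ g₁) (hg₁1 : g₁ ≤ 1) (hg₂ : 0 ≤ g₂) (hg₂1 : g₂ ≤ 1) (hw₁ : 0 < w₁) (hw₂ : 0 < w₂)
    {k : ℕ} (r c : Fin k → ℕ) (hr : StrictMono r) (hc : StrictMono c) :
    0 ≤ (Matrix.of fun i j =>
        (lam ^ 2 * (g₁ * g₂ * (r i : ℝ) * ((r i : ℝ) - 1) + (g₁ + g₂) * (p + 1) * (r i : ℝ) + p * (p + 1)))
            * ((r i).choose (c j) : ℝ)
        + (lam * (r i : ℝ) * ((w₁ * g₂ + w₂ * g₁) * ((r i : ℝ) - 1) + (w₁ + w₂) * (p + 1)))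
            * (((r i) - 1).choose (c j) : ℝ)
        + (w₁ * w₂ * (r i : ℝ) * ((r i : ℝ) - 1)) * (((r i) - 2).choose (c j) : ℝ)).det := by
  let A : ℕ → ℝ := fun n =>
    lam ^ 2 * (g₁ * g₂ * (n : ℝ) * ((n : ℝ) - 1) + (g₁ + g₂) * (p + 1) * (n : ℝ) + p * (p + 1))
  let B : ℕ → ℝ := fun n => lam * (n : ℝ) * ((w₁ * g₂ + w₂ * g₁) * ((n : ℝ) - 1) + (w₁ + w₂) * (p + 1))
  let C : ℕ → ℝ := fun n => w₁ * w₂ * (n : ℝ) * ((n : ℝ) - 1)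
  have hn01 : ∀ n : ℕ, (0 : ℝ) ≤ (n : ℝ) * ((n : ℝ) - 1) := by
    intro n
    rcases Nat.eq_zero_or_pos n with h0 | h1
    · subst h0; simp
    · have : (1 : ℝ) ≤ n := by exact_mod_cast h1
      exact mul_nonneg (by linarith) (by linarith)
  refine BandTwoTN.bandTwo_choose_tn A B C ?_ ?_ ?_ ?_ ?_ ?_ ?_ r c hr hc
  · intro n
    show 0 < lam ^ 2 * (g₁ * g₂ * (n : ℝ) * ((n : ℝ) - 1) + (g₁ + g₂) * (p + 1) * (n : ℝ) + p * (p + 1))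
    have h2 : 0 ≤ g₁ * g₂ * (n : ℝ) * ((n : ℝ) - 1) := by
      have := mul_nonneg (mul_nonneg hg₁ hg₂) (hn01 n); linarith
    have h3 : 0 ≤ (g₁ + g₂) * (p + 1) * (n : ℝ) := by positivity
    positivity
  · intro n hn
    show 0 < lam * (n : ℝ) * ((w₁ * g₂ + w₂ * g₁) * ((n : ℝ) - 1) + (w₁ + w₂) * (p + 1))
    have h1 : (1 : ℝ) ≤ n := by exact_mod_cast hn
    have h2 : 0 ≤ (w₁ * g₂ + w₂ * g₁) * ((n : ℝ) - 1) :=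
      mul_nonneg (by positivity) (by linarith)
    have h3 : 0 < (w₁ + w₂) * (p + 1) := by positivity
    have h4 : 0 < lam * (n : ℝ) := by positivity
    exact mul_pos h4 (by linarith)
  · show lam * ((0 : ℕ) : ℝ) * _ = 0
    simp
  · intro n
    show 0 ≤ w₁ * w₂ * (n : ℝ) * ((n : ℝ) - 1)
    have := mul_nonneg (mul_pos hw₁ hw₂).le (hn01 n); linarith
  · show w₁ * w₂ * ((0 : ℕ) : ℝ) * _ = 0
    simp
  · show w₁ * w₂ * ((1 : ℕ) : ℝ) * (((1 : ℕ) : ℝ) - 1) = 0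
    simp
  · intro n hn
    obtain ⟨m, rfl⟩ : ∃ m, n = m + 2 := ⟨n - 2, by omega⟩
    have e1 : (m + 2 - 1 : ℕ) = m + 1 := by omega
    rw [e1]
    show 4 * (lam ^ 2 * (g₁ * g₂ * ((m + 1 : ℕ) : ℝ) * (((m + 1 : ℕ) : ℝ) - 1) + (g₁ + g₂) * (p + 1) * ((m + 1 : ℕ) : ℝ)
        + p * (p + 1)) * (w₁ * w₂ * ((m + 2 : ℕ) : ℝ) * (((m + 2 : ℕ) : ℝ) - 1)))
      ≤ (lam * ((m + 1 : ℕ) : ℝ) * ((w₁ * g₂ + w₂ * g₁) * (((m + 1 : ℕ) : ℝ) - 1) + (w₁ + w₂) * (p + 1)))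
        * (lam * ((m + 2 : ℕ) : ℝ) * ((w₁ * g₂ + w₂ * g₁) * (((m + 2 : ℕ) : ℝ) - 1) + (w₁ + w₂) * (p + 1)))
    push_cast
    have hm0 : (0 : ℝ) ≤ (m : ℝ) := by positivity
    have hcl := chain_poly ((m : ℝ) + 1) (p + 1) g₁ g₂ w₁ w₂ (by linarith) (by linarith) hg₁ hg₁1 hg₂ hg₂1
    have hpos : (0 : ℝ) ≤ lam ^ 2 * ((m : ℝ) + 2) * ((m : ℝ) + 1) := by positivity
    have e : (lam * ((m : ℝ) + 1) * ((w₁ * g₂ + w₂ * g₁) * ((m : ℝ) + 1 - 1) + (w₁ + w₂) * (p + 1)))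
        * (lam * ((m : ℝ) + 2) * ((w₁ * g₂ + w₂ * g₁) * ((m : ℝ) + 2 - 1) + (w₁ + w₂) * (p + 1)))
        - 4 * (lam ^ 2 * (g₁ * g₂ * ((m : ℝ) + 1) * ((m : ℝ) + 1 - 1) + (g₁ + g₂) * (p + 1) * ((m : ℝ) + 1)
          + p * (p + 1)) * (w₁ * w₂ * ((m : ℝ) + 2) * ((m : ℝ) + 2 - 1)))
        = lam ^ 2 * ((m : ℝ) + 2) * ((m : ℝ) + 1) *
          (((w₁ * g₂ + w₂ * g₁) * ((m : ℝ) + 1 - 1) + (w₁ + w₂) * (p + 1)) * ((w₁ * g₂ + w₂ * g₁) * ((m : ℝ) + 1) + (w₁ + w₂) * (p + 1))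
           - 4 * w₁ * w₂ * (g₁ * g₂ * ((m : ℝ) + 1) * ((m : ℝ) + 1 - 1) + (g₁ + g₂) * (p + 1) * ((m : ℝ) + 1) + (p + 1 - 1) * (p + 1))) := by
      ring
    have hdiff : 0 ≤ ((w₁ * g₂ + w₂ * g₁) * ((m : ℝ) + 1 - 1) + (w₁ + w₂) * (p + 1)) * ((w₁ * g₂ + w₂ * g₁) * ((m : ℝ) + 1) + (w₁ + w₂) * (p + 1))
           - 4 * w₁ * w₂ * (g₁ * g₂ * ((m : ℝ) + 1) * ((m : ℝ) + 1 - 1) + (g₁ + g₂) * (p + 1) * ((m : ℝ) + 1) + (p + 1 - 1) * (p + 1)) := by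
      linarith [hcl]
    nlinarith [mul_nonneg hpos hdiff, e]

end BandTwoNeutral

end Summit.CriticalPhenomena.PercolationContinuityZ3.Theorems
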